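import Summits.AtomisticToContinuum.Crystallization.Theorems.ChartedPlanarOrderStraddleSummable

/-!
# W SPLIT over the landed PS node (decomp-a2c lens-3 g23): `TubeMonotone ⟸ far-pair ℓ¹ stiffness ∧ adjacent-pair dominance`

The last open piece of the PS column, W `TubeMonotone Λ η` of `…Theorems.ChartedPlanarOrderProfileSlavingLJ`, is cut along the
NEAR-PAIR DIAGONAL DOMINANCE of the gap–gap stiffness.  Dictionary facts (exact): `gapStress a b m h = Σ_{k<m≤l} layerForce a b (−offsetOf h k l)`;
EVERY straddling pair `(k,l)` contains the own increment `h m`, and the pairs reacting to `h (m+j)` are the SUB-family spanning both gaps;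
a pair of span `s = l − k` straddles `s` gaps and contains `s` increments.  Hence, with span-indexed Lipschitz moduli `τ s` of the pair forces
on the `η`-tube (`IsPairModulus`), the gap-level `ℓ¹` profile is `kap τ j = Σ_s cnt s j · τ s` (`cnt s j = #{pairs of span s straddling a gap and
containing the increment j places away} = (s − |j|)⁺`), with `Σ_j kap τ j ≤ Σ_s s²·τ s`, `Σ_j |j|·kap τ j ≤ Σ_s s³·τ s`, and the own-gap monotonicity
constant is `λ₁(adjacent pair) − (far straddling mass) = λ₁ − (kap τ 0 − τ 1)`; W's inequality `Σ_j κ_j − κ_0 < λ` becomes `Σ_s s² τ s − τ 1 < λ₁`.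

PIECES (Props, this file; binder lists copy the landed `TubeMonotone` exactly):
* W_far `FarPairStiffnessL1 Λ η K` [ANALYTIC · ATTACKABLE with the D1s technology one power up]: every admissible configuration carries span
  moduli `τ ≥ 0` with `Σ s³ τ s < ∞`, far mass `Σ_s s² τ s − τ 1 ≤ K δ`, and the pair-force Lipschitz bounds on the tube;
* W_near `AdjacentPairDominance Λ η K` [TWO-LAYER statement · CERT/INSTRUMENTABLE = census TAG 138′ restricted to nearest layers]: the
  adjacent-pair map `u ↦ layerForce a b (−u)` is `λ₁`-strongly monotone on the tube window of every increment, with `λ₁ > K δ`.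
★ GLUE PROVED: `tubeMonotone_of_near_far : StraddleSummable Λ → FarPairStiffnessL1 Λ η K → AdjacentPairDominance Λ η K → TubeMonotone Λ η`
(every `K : ℝ → ℝ`); with D1s landed (`straddleSummable_holds`): `tubeMonotone_of_near_far'` and ★ `profileSlavingLJ_of_near_far :
FarPairStiffnessL1 Λ η K → AdjacentPairDominance Λ η K → ProfileSlavingLJ Λ η` — the PS column of record is PS_LJ ⟸ W_far ∧ W_near.
READING RULE (critic row 419 (1), inherited from W): read for `η < ½ · inf_m ⟪n, incr w m⟫/‖n‖` (tube profiles keep the layers apart, no junk-`0`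
lattice sum); `λ₁, τ` may depend on the configuration, `K` only on `δ`.  Def-bearing (three Props, `cnt`, `kap`, `famOf`); no sorry.
-/

noncomputable section

open Metric
open scoped RealInnerProductSpace
open Summit.AtomisticToContinuum.Crystallization.Theorems.ChartedPlanarOrderRigidityDoor
open Summit.AtomisticToContinuum.Crystallization.Theorems.ChartedPlanarOrderDensityDichotomy
open Summit.AtomisticToContinuum.Crystallization.Theorems.ChartedPlanarOrderMesoCut
open Summit.AtomisticToContinuum.Crystallization.Theorems.ChartedPlanarOrderDoorLayered (Layered)
open Summit.AtomisticToContinuum.Crystallization.Theorems.ChartedPlanarOrderProfileSlavingLJ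
open Summit.AtomisticToContinuum.Crystallization.Theorems.ChartedPlanarOrderProfileSlavingLJBalance

namespace Summit.AtomisticToContinuum.Crystallization.Theorems.ChartedPlanarOrderTubeMonotoneSplit

/-! ## 1. The pieces -/

/-- **span-indexed pair moduli on the tube** (configuration-level): the force between layers `k < l`, as a function of the increment profile
through `offsetOf h k l`, is `τ (l − k)`-Lipschitz along tube profiles. -/
def IsPairModulus (a b : E3) (w : ℤ → E3) (η : ℝ) (τ : ℕ → ℝ) : Prop :=
  ∀ k l : ℤ, k < l → ∀ h h' : ℤ → E3, (∀ i, h i ∈ tube w η i) → (∀ i, h' i ∈ tube w η i) →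
    ‖layerForce a b (-offsetOf h k l) - layerForce a b (-offsetOf h' k l)‖ ≤
      τ (l - k).toNat * ‖offsetOf h k l - offsetOf h' k l‖

/-- **W_far «FarPairStiffnessL1 Λ η K»** (ANALYTIC · ATTACKABLE): around every clean separated Nash stacked layered LJ configuration with in-plane
periods of norm `≤ Λ` the layer-pair forces have span-indexed tube moduli `τ ≥ 0` with finite third moment and FAR MASS `Σ_s s²·τ s − τ 1 ≤ K δ`. -/
def FarPairStiffnessL1 (Λ η : ℝ) (K : ℝ → ℝ) : Prop :=
  ∀ δ : ℝ, 0 < δ → ∀ (a b : E3) (w : ℤ → E3), ‖a‖ ≤ Λ → ‖b‖ ≤ Λ →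
    IsSep δ (Layered a b w) → IsClean (μS (Layered a b w)) → IsNash (μS (Layered a b w)) → IsStacked a b w →
    ∃ τ : ℕ → ℝ, (∀ s, 0 ≤ τ s) ∧ Summable (fun s : ℕ => (s : ℝ) ^ 3 * τ s) ∧
      (∑' s : ℕ, (s : ℝ) ^ 2 * τ s) - τ 1 ≤ K δ ∧ IsPairModulus a b w η τ

/-- **W_near «AdjacentPairDominance Λ η K»** (TWO-LAYER · CERT/INSTRUMENTABLE, census TAG 138′-near): around every clean separated Nash stacked
layered LJ configuration with in-plane periods of norm `≤ Λ`, the adjacent-pair force map `u ↦ layerForce a b (−u)` is `λ₁`-strongly monotone on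
the tube window of every increment, with `λ₁ > K δ` (the far-mass budget of W_far). -/
def AdjacentPairDominance (Λ η : ℝ) (K : ℝ → ℝ) : Prop :=
  ∀ δ : ℝ, 0 < δ → ∀ (a b : E3) (w : ℤ → E3), ‖a‖ ≤ Λ → ‖b‖ ≤ Λ →
    IsSep δ (Layered a b w) → IsClean (μS (Layered a b w)) → IsNash (μS (Layered a b w)) → IsStacked a b w →
    ∃ lam₁ : ℝ, K δ < lam₁ ∧ ∀ m : ℤ, ∀ u ∈ tube w η m, ∀ u' ∈ tube w η m,
      lam₁ * ‖u - u'‖ ^ 2 ≤ ⟪layerForce a b (-u) - layerForce a b (-u'), u - u'⟫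

/-- number of pairs `(k, k+s)` straddling gap `0` (`k < 0 ≤ k+s`) whose increment window `(k, k+s]` contains `j`; equals `(s − |j|)⁺`. -/
def cnt (s : ℕ) (j : ℤ) : ℕ := ((Finset.Ico (-(s : ℤ)) 0).filter (fun k => k < j ∧ j ≤ k + s)).card

/-- `cnt s j ≤ s`. -/
theorem cnt_le (s : ℕ) (j : ℤ) : cnt s j ≤ s := by
  refine (Finset.card_filter_le _ _).trans ?_
  rw [Int.card_Ico]; simp

/-- a pair counted by `cnt s j` forces `|j| ≤ s`. -/
theorem abs_le_of_cnt_ne_zero {s : ℕ} {j : ℤ} (h : cnt s j ≠ 0) : |j| ≤ s := by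
  obtain ⟨k, hk⟩ := Finset.card_ne_zero.mp h
  simp only [Finset.mem_filter, Finset.mem_Ico] at hk
  rw [abs_le]; constructor <;> omega

/-- double counting: `Σ_{j ∈ J} cnt s j ≤ s²` (each of the `s` pairs of span `s` contains `s` increments). -/
theorem sum_cnt_le (s : ℕ) (J : Finset ℤ) : ∑ j ∈ J, cnt s j ≤ s ^ 2 := by
  unfold cnt
  simp_rw [Finset.card_filter]
  rw [Finset.sum_comm]
  calc ∑ k ∈ Finset.Ico (-(s : ℤ)) 0, ∑ j ∈ J, (if k < j ∧ j ≤ k + s then 1 else 0)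
      ≤ ∑ k ∈ Finset.Ico (-(s : ℤ)) 0, s := Finset.sum_le_sum fun k _ => by
        rw [← Finset.card_filter]
        calc (J.filter (fun j => k < j ∧ j ≤ k + s)).card ≤ (Finset.Ioc k (k + s)).card :=
              Finset.card_le_card fun j hj => by
                simp only [Finset.mem_filter] at hj
                exact Finset.mem_Ioc.mpr hj.2
          _ = s := by rw [Int.card_Ioc]; simp
    _ = s ^ 2 := by rw [Finset.sum_const, Int.card_Ico, smul_eq_mul]; simp [sq]

/-- first-moment counting: `Σ_{j ∈ J} |j| · cnt s j ≤ s³`. -/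
theorem sum_abs_mul_cnt_le (s : ℕ) (J : Finset ℤ) : ∑ j ∈ J, |(j : ℝ)| * (cnt s j : ℝ) ≤ (s : ℝ) ^ 3 := by
  calc ∑ j ∈ J, |(j : ℝ)| * (cnt s j : ℝ) ≤ ∑ j ∈ J, (s : ℝ) * (cnt s j : ℝ) := Finset.sum_le_sum fun j _ => by
        by_cases hc : cnt s j = 0
        · simp [hc]
        · refine mul_le_mul_of_nonneg_right ?_ (Nat.cast_nonneg _)
          rw [← Int.cast_abs]; exact_mod_cast abs_le_of_cnt_ne_zero hc
    _ = (s : ℝ) * ∑ j ∈ J, (cnt s j : ℝ) := (Finset.mul_sum _ _ _).symm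
    _ ≤ (s : ℝ) * (s : ℝ) ^ 2 := mul_le_mul_of_nonneg_left (by exact_mod_cast sum_cnt_le s J) (Nat.cast_nonneg _)
    _ = (s : ℝ) ^ 3 := by ring

/-- the gap-level `ℓ¹` profile induced by span moduli: `kap τ j = Σ_s cnt s j · τ s`. -/
def kap (τ : ℕ → ℝ) (j : ℤ) : ℝ := ∑' s : ℕ, (cnt s j : ℝ) * τ s

variable {τ : ℕ → ℝ}

/-- comparison summability: a profile dominated by `s³ τ s` is summable. -/
theorem summable_mul_of_le (hτ0 : ∀ s, 0 ≤ τ s) (hτ3 : Summable (fun s : ℕ => (s : ℝ) ^ 3 * τ s)) {c : ℕ → ℝ}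
    (hc0 : ∀ s, 0 ≤ c s) (hc : ∀ s, c s ≤ (s : ℝ) ^ 3) : Summable (fun s : ℕ => c s * τ s) :=
  hτ3.of_nonneg_of_le (fun s => mul_nonneg (hc0 s) (hτ0 s)) (fun s => mul_le_mul_of_nonneg_right (hc s) (hτ0 s))

/-- `s ≤ s³` over `ℕ`, cast. -/
theorem natCast_le_pow_three (s : ℕ) : (s : ℝ) ≤ (s : ℝ) ^ 3 := by exact_mod_cast Nat.le_self_pow (by norm_num) s

/-- `s² ≤ s³` over `ℕ`, cast. -/
theorem sq_le_pow_three (s : ℕ) : (s : ℝ) ^ 2 ≤ (s : ℝ) ^ 3 := by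
  rcases Nat.eq_zero_or_pos s with rfl | hs
  · simp
  exact_mod_cast Nat.pow_le_pow_right hs (by norm_num : 2 ≤ 3)

/-- the fibres of `kap` are summable. -/
theorem summable_cnt_mul (hτ0 : ∀ s, 0 ≤ τ s) (hτ3 : Summable (fun s : ℕ => (s : ℝ) ^ 3 * τ s)) (j : ℤ) :
    Summable (fun s : ℕ => (cnt s j : ℝ) * τ s) :=
  summable_mul_of_le hτ0 hτ3 (fun s => Nat.cast_nonneg _)
    (fun s => le_trans (by exact_mod_cast cnt_le s j) (natCast_le_pow_three s))

/-- `kap τ ≥ 0`. -/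
theorem kap_nonneg (hτ0 : ∀ s, 0 ≤ τ s) (j : ℤ) : 0 ≤ kap τ j := tsum_nonneg fun s => mul_nonneg (Nat.cast_nonneg _) (hτ0 s)

/-- partial sums of `kap`: `Σ_{j ∈ J} kap τ j ≤ Σ_s s² τ s`. -/
theorem sum_kap_le (hτ0 : ∀ s, 0 ≤ τ s) (hτ3 : Summable (fun s : ℕ => (s : ℝ) ^ 3 * τ s)) (J : Finset ℤ) :
    ∑ j ∈ J, kap τ j ≤ ∑' s : ℕ, (s : ℝ) ^ 2 * τ s := by
  unfold kap; rw [← Summable.tsum_finsetSum (fun j _ => summable_cnt_mul hτ0 hτ3 j)]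
  refine Summable.tsum_le_tsum (fun s => ?_) (summable_sum fun j _ => summable_cnt_mul hτ0 hτ3 j)
    (summable_mul_of_le hτ0 hτ3 (fun s => sq_nonneg _) sq_le_pow_three)
  rw [← Finset.sum_mul]
  exact mul_le_mul_of_nonneg_right (by exact_mod_cast sum_cnt_le s J) (hτ0 s)

/-- `kap τ` is summable. -/
theorem summable_kap (hτ0 : ∀ s, 0 ≤ τ s) (hτ3 : Summable (fun s : ℕ => (s : ℝ) ^ 3 * τ s)) : Summable (kap τ) :=
  summable_of_sum_le (fun j => kap_nonneg hτ0 j) (sum_kap_le hτ0 hτ3)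

/-- total mass of `kap`: `Σ_j kap τ j ≤ Σ_s s² τ s`. -/
theorem tsum_kap_le (hτ0 : ∀ s, 0 ≤ τ s) (hτ3 : Summable (fun s : ℕ => (s : ℝ) ^ 3 * τ s)) :
    ∑' j : ℤ, kap τ j ≤ ∑' s : ℕ, (s : ℝ) ^ 2 * τ s :=
  Real.tsum_le_of_sum_le (fun j => kap_nonneg hτ0 j) (sum_kap_le hτ0 hτ3)

/-- partial first moments of `kap`: `Σ_{j ∈ J} |j| kap τ j ≤ Σ_s s³ τ s`. -/
theorem sum_abs_mul_kap_le (hτ0 : ∀ s, 0 ≤ τ s) (hτ3 : Summable (fun s : ℕ => (s : ℝ) ^ 3 * τ s)) (J : Finset ℤ) :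
    ∑ j ∈ J, |(j : ℝ)| * kap τ j ≤ ∑' s : ℕ, (s : ℝ) ^ 3 * τ s := by
  have hmul : ∀ j : ℤ, |(j : ℝ)| * kap τ j = ∑' s : ℕ, (|(j : ℝ)| * (cnt s j : ℝ)) * τ s := fun j => by
    rw [kap, ← tsum_mul_left]
    exact tsum_congr fun s => by ring
  have hsf : ∀ j : ℤ, Summable (fun s : ℕ => (|(j : ℝ)| * (cnt s j : ℝ)) * τ s) := fun j => by
    simp_rw [mul_assoc]
    exact (summable_cnt_mul hτ0 hτ3 j).mul_left _
  simp_rw [hmul]; rw [← Summable.tsum_finsetSum (fun j _ => hsf j)]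
  refine Summable.tsum_le_tsum (fun s => ?_) (summable_sum fun j _ => hsf j) hτ3
  rw [← Finset.sum_mul]
  exact mul_le_mul_of_nonneg_right (sum_abs_mul_cnt_le s J) (hτ0 s)

/-- `j ↦ |j| · kap τ j` is summable (finite first moment). -/
theorem summable_abs_mul_kap (hτ0 : ∀ s, 0 ≤ τ s) (hτ3 : Summable (fun s : ℕ => (s : ℝ) ^ 3 * τ s)) :
    Summable (fun j : ℤ => |(j : ℝ)| * kap τ j) :=
  summable_of_sum_le (fun j => mul_nonneg (abs_nonneg _) (kap_nonneg hτ0 j)) (sum_abs_mul_kap_le hτ0 hτ3)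

variable {a b : E3} {w : ℤ → E3} {η : ℝ} {m : ℤ}

/-- a tube is nonempty only for `η ≥ 0`. -/
theorem eta_nonneg {h : ℤ → E3} (hh : ∀ i, h i ∈ tube w η i) : 0 ≤ η := by
  have h0 := hh 0; rw [tube, mem_closedBall] at h0
  exact dist_nonneg.trans h0

/-- the configuration's own increments lie in its tube. -/
theorem incr_mem_tube (hη : 0 ≤ η) (i : ℤ) : incr w i ∈ tube w η i := mem_closedBall_self hη

/-- two tube profiles differ by at most `2η` in every increment. -/
theorem norm_sub_le_two_eta {h h' : ℤ → E3} (hh : ∀ i, h i ∈ tube w η i) (hh' : ∀ i, h' i ∈ tube w η i) (i : ℤ) :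
    ‖h i - h' i‖ ≤ 2 * η := by
  have h1 := hh i; have h2 := hh' i
  rw [tube, mem_closedBall, dist_eq_norm] at h1 h2
  calc ‖h i - h' i‖ = ‖(h i - incr w i) - (h' i - incr w i)‖ := by congr 1; abel
    _ ≤ ‖h i - incr w i‖ + ‖h' i - incr w i‖ := norm_sub_le _ _
    _ ≤ 2 * η := by linarith

/-- updating one increment inside its window keeps a tube profile in the tube. -/
theorem update_mem_tube {h : ℤ → E3} (hh : ∀ i, h i ∈ tube w η i) {b' : E3} (hb' : b' ∈ tube w η m) (i : ℤ) :
    Function.update h m b' i ∈ tube w η i := by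
  rcases eq_or_ne i m with rfl | hne
  · rw [Function.update_self]; exact hb'
  rw [Function.update_of_ne hne]; exact hh i

/-- the straddling layer-pair family of gap `m` on an increment profile `h` (`gapStress a b m h` is its sum). -/
def famOf (a b : E3) (m : ℤ) (h : ℤ → E3) (p : Straddle m) : E3 := layerForce a b (-offsetOf h p.1.1 p.1.2)

/-- `gapStress = Σ famOf` (definitional). -/
theorem gapStress_eq_tsum (h : ℤ → E3) : gapStress a b m h = ∑' p, famOf a b m h p := rfl

/-- on the configuration's own increments the family is the layer-pair family `layerForce a b (w k − w l)`. -/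
theorem famOf_incr (a b : E3) (w : ℤ → E3) (m : ℤ) :
    famOf a b m (incr w) = fun p : Straddle m => layerForce a b (w p.1.1 - w p.1.2) := by
  funext p; simp only [famOf]; rw [offsetOf_incr w (p.2.1.le.trans p.2.2), neg_sub]

/-- along two profiles the offsets of a straddling pair differ by the sum of the increment differences. -/
theorem norm_offsetOf_sub_le (h h' : ℤ → E3) (k l : ℤ) :
    ‖offsetOf h k l - offsetOf h' k l‖ ≤ ∑ i ∈ Finset.Ioc k l, ‖h i - h' i‖ := by
  simp only [offsetOf, ← Finset.sum_sub_distrib]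
  exact norm_sum_le _ _

/-- updating the own increment `h m ↦ b'` shifts every straddling offset by `h m − b'`. -/
theorem offsetOf_sub_offsetOf_update (h : ℤ → E3) (b' : E3) (p : Straddle m) :
    offsetOf h p.1.1 p.1.2 - offsetOf (Function.update h m b') p.1.1 p.1.2 = h m - b' := by
  simp only [offsetOf, ← Finset.sum_sub_distrib]
  rw [Finset.sum_eq_single_of_mem m (Finset.mem_Ioc.mpr ⟨p.2.1, p.2.2⟩) (fun i _ hne => by
    rw [Function.update_of_ne hne, sub_self])]
  rw [Function.update_self]

/-- the adjacent pair `(m−1, m)` reads the own increment: `offsetOf h (m−1) m = h m`. -/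
theorem offsetOf_pred (h : ℤ → E3) (m : ℤ) : offsetOf h (m - 1) m = h m := by
  have : Finset.Ioc (m - 1) m = {m} := by
    ext i; simp only [Finset.mem_Ioc, Finset.mem_singleton]; omega
  simp only [offsetOf, this, Finset.sum_singleton]

/-- the pairs of span `s` through increment `i` inject into the model count `cnt s (i − m)` (shift by `m`). -/
theorem card_filter_span_le (P : Finset (Straddle m)) (i : ℤ) (s : ℕ) :
    (P.filter (fun p => (p.1.1 < i ∧ i ≤ p.1.2) ∧ (p.1.2 - p.1.1).toNat = s)).card ≤ cnt s (i - m) := by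
  unfold cnt
  refine Finset.card_le_card_of_injOn (fun p => p.1.1 - m) (fun p hp => ?_) (fun p hp q hq hpq => ?_)
  · obtain ⟨-, ⟨hki, hil⟩, hs⟩ := Finset.mem_filter.mp (Finset.mem_coe.mp hp)
    have h1 := p.2.1; have h2 := p.2.2
    have hkl : (p.1.2 - p.1.1 : ℤ) = s := by rw [← hs, Int.toNat_of_nonneg]; omega
    refine Finset.mem_coe.mpr (Finset.mem_filter.mpr ⟨Finset.mem_Ico.mpr ⟨?_, ?_⟩, ?_, ?_⟩) <;> dsimp only <;> omega
  · have hp' := (Finset.mem_filter.mp (Finset.mem_coe.mp hp)).2.2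
    have hq' := (Finset.mem_filter.mp (Finset.mem_coe.mp hq)).2.2
    have hp1 := p.2.1; have hp2 := p.2.2; have hq1 := q.2.1; have hq2 := q.2.2
    have e1 : p.1.1 = q.1.1 := by have := hpq; dsimp only at this; omega
    have ep : (p.1.2 - p.1.1 : ℤ) = s := by rw [← hp', Int.toNat_of_nonneg]; omega
    have eq' : (q.1.2 - q.1.1 : ℤ) = s := by rw [← hq', Int.toNat_of_nonneg]; omega
    have e2 : p.1.2 = q.1.2 := by omega
    exact Subtype.ext (Prod.ext e1 e2)

section Moduli
variable (hτ0 : ∀ s, 0 ≤ τ s) (hτ3 : Summable (fun s : ℕ => (s : ℝ) ^ 3 * τ s))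
include hτ0 hτ3

/-- grouping by span: the moduli of the pairs of `P` through increment `i` sum to at most `kap τ (i − m)`. -/
theorem sum_filter_tau_le (P : Finset (Straddle m)) (i : ℤ) :
    ∑ p ∈ P.filter (fun p => p.1.1 < i ∧ i ≤ p.1.2), τ (p.1.2 - p.1.1).toNat ≤ kap τ (i - m) := by
  classical
  set Pf := P.filter (fun p => p.1.1 < i ∧ i ≤ p.1.2) with hPf
  let T : Finset ℕ := Pf.image fun p => (p.1.2 - p.1.1).toNat
  rw [← Finset.sum_fiberwise_of_maps_to (s := Pf) (t := T) (g := fun p => (p.1.2 - p.1.1).toNat)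
    (fun p hp => Finset.mem_image_of_mem _ hp)]
  have hT : ∀ s ∈ T, ∑ p ∈ Pf.filter (fun p => (p.1.2 - p.1.1).toNat = s), τ (p.1.2 - p.1.1).toNat
      ≤ (cnt s (i - m) : ℝ) * τ s := fun s _ => by
    rw [Finset.sum_congr rfl (fun p hp => by rw [(Finset.mem_filter.mp hp).2]), Finset.sum_const, nsmul_eq_mul]
    refine mul_le_mul_of_nonneg_right ?_ (hτ0 s)
    have := card_filter_span_le P i s
    rw [← Finset.filter_filter] at this
    exact_mod_cast this
  refine (Finset.sum_le_sum hT).trans ?_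
  exact (summable_cnt_mul hτ0 hτ3 (i - m)).sum_le_tsum T (fun s _ => mul_nonneg (Nat.cast_nonneg _) (hτ0 s))

/-- all moduli of the straddling pairs of `P` sum to at most `kap τ 0` (every straddling pair contains the own increment). -/
theorem sum_tau_le (P : Finset (Straddle m)) : ∑ p ∈ P, τ (p.1.2 - p.1.1).toNat ≤ kap τ 0 := by
  have h := sum_filter_tau_le hτ0 hτ3 P m
  rw [Finset.filter_true_of_mem (fun p _ => ⟨p.2.1, p.2.2⟩), sub_self] at h
  exact h

/-- the weighted increment differences of two tube profiles are summable against the shifted profile. -/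
theorem summable_kap_shift_mul {h h' : ℤ → E3} (hh : ∀ i, h i ∈ tube w η i) (hh' : ∀ i, h' i ∈ tube w η i) (m : ℤ) :
    Summable (fun i : ℤ => kap τ (i - m) * ‖h i - h' i‖) := by
  have hk : Summable (fun i : ℤ => kap τ (i - m)) := by
    change Summable ((kap τ) ∘ fun i : ℤ => i - m); exact (summable_kap hτ0 hτ3).comp_injective sub_left_injective
  refine (hk.mul_right (2 * η)).of_nonneg_of_le (fun i => mul_nonneg (kap_nonneg hτ0 _) (norm_nonneg _)) (fun i => ?_)
  exact mul_le_mul_of_nonneg_left (norm_sub_le_two_eta hh hh' i) (kap_nonneg hτ0 _)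

/-- ★ CORE (sub-sum bookkeeping): along tube profiles, partial sums of the straddle-family differences are controlled by the `kap`-weighted
`ℓ¹` distance of the increment profiles. -/
theorem sum_norm_sub_le (hP : IsPairModulus a b w η τ) {h h' : ℤ → E3} (hh : ∀ i, h i ∈ tube w η i)
    (hh' : ∀ i, h' i ∈ tube w η i) (P : Finset (Straddle m)) :
    ∑ p ∈ P, ‖famOf a b m h p - famOf a b m h' p‖ ≤ ∑' i : ℤ, kap τ (i - m) * ‖h i - h' i‖ := by
  classical
  have step1 : ∀ p : Straddle m, ‖famOf a b m h p - famOf a b m h' p‖ ≤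
      ∑ i ∈ Finset.Ioc p.1.1 p.1.2, τ (p.1.2 - p.1.1).toNat * ‖h i - h' i‖ := fun p => by
    have hkl : p.1.1 < p.1.2 := lt_of_lt_of_le p.2.1 p.2.2
    refine (hP _ _ hkl h h' hh hh').trans ?_
    rw [← Finset.mul_sum]
    exact mul_le_mul_of_nonneg_left (norm_offsetOf_sub_le h h' _ _) (hτ0 _)
  refine (Finset.sum_le_sum fun p _ => step1 p).trans ?_
  rw [Finset.sum_comm' (t' := P.biUnion fun p => Finset.Ioc p.1.1 p.1.2)
    (s' := fun i => P.filter fun p => p.1.1 < i ∧ i ≤ p.1.2) (fun p i => by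
      simp only [Finset.mem_filter, Finset.mem_biUnion, Finset.mem_Ioc]
      constructor
      · rintro ⟨hp, hki, hil⟩
        exact ⟨⟨hp, hki, hil⟩, p, hp, hki, hil⟩
      · rintro ⟨⟨hp, hki, hil⟩, -⟩
        exact ⟨hp, hki, hil⟩)]
  have hI : ∀ i ∈ P.biUnion (fun p => Finset.Ioc p.1.1 p.1.2),
      ∑ p ∈ P.filter (fun p => p.1.1 < i ∧ i ≤ p.1.2), τ (p.1.2 - p.1.1).toNat * ‖h i - h' i‖
        ≤ kap τ (i - m) * ‖h i - h' i‖ := fun i _ => by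
    rw [← Finset.sum_mul]
    exact mul_le_mul_of_nonneg_right (sum_filter_tau_le hτ0 hτ3 P i) (norm_nonneg _)
  refine (Finset.sum_le_sum hI).trans ?_
  exact (summable_kap_shift_mul hτ0 hτ3 hh hh' m).sum_le_tsum _
    (fun i _ => mul_nonneg (kap_nonneg hτ0 _) (norm_nonneg _))

/-- norms of the straddle-family differences along tube profiles are summable. -/
theorem summable_norm_famOf_sub (hP : IsPairModulus a b w η τ) {h h' : ℤ → E3} (hh : ∀ i, h i ∈ tube w η i)
    (hh' : ∀ i, h' i ∈ tube w η i) : Summable (fun p : Straddle m => ‖famOf a b m h p - famOf a b m h' p‖) :=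
  summable_of_sum_le (fun _ => norm_nonneg _) (sum_norm_sub_le hτ0 hτ3 hP hh hh')

/-- the straddle family is summable on every tube profile once it is on the configuration's own increments (D1s). -/
theorem summable_famOf (hSm : Summable (famOf a b m (incr w))) (hP : IsPairModulus a b w η τ) {h : ℤ → E3}
    (hh : ∀ i, h i ∈ tube w η i) : Summable (famOf a b m h) := by
  have h0 := eta_nonneg hh
  have hd := (summable_norm_famOf_sub hτ0 hτ3 hP hh (incr_mem_tube h0) (m := m)).of_norm
  have he : famOf a b m h = fun p => (famOf a b m h p - famOf a b m (incr w) p) + famOf a b m (incr w) p := by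
    funext p; rw [sub_add_cancel]
  rw [he]
  exact hd.add hSm

end Moduli

/-! ## 5. ★ The glue: W ⟸ W_far ∧ W_near -/

/-- ★ **W ⟸ D1s ∧ W_far ∧ W_near** (PROVED): straddle summability + far-pair `ℓ¹` stiffness with budget `K` + adjacent-pair dominance over
`K` ⇒ `TubeMonotone Λ η`, with `λ = λ₁ − (kap τ 0 − τ 1)` and `κ = kap τ`. -/
theorem tubeMonotone_of_near_far {Λ η : ℝ} {K : ℝ → ℝ} (hS : StraddleSummable Λ) (hF : FarPairStiffnessL1 Λ η K)
    (hN : AdjacentPairDominance Λ η K) : TubeMonotone Λ η := by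
  classical
  intro δ hδ a b w ha hb hs hc hn hst
  obtain ⟨τ, hτ0, hτ3, hK, hP⟩ := hF δ hδ a b w ha hb hs hc hn hst
  obtain ⟨lam₁, hlam, hmono⟩ := hN δ hδ a b w ha hb hs hc hn hst
  have hSm : ∀ m : ℤ, Summable (famOf a b m (incr w)) := fun m => by
    rw [famOf_incr]; exact hS δ hδ a b w ha hb hs hc hn hst m
  refine ⟨lam₁ - (kap τ 0 - τ 1), kap τ, kap_nonneg hτ0, summable_kap hτ0 hτ3, summable_abs_mul_kap hτ0 hτ3,
    by linarith [tsum_kap_le hτ0 hτ3], fun m h hh b' hb' => ?_, fun m h h' hh hh' => ?_⟩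
  · -- strong monotonicity in the own increment
    have hh' : ∀ i, Function.update h m b' i ∈ tube w η i := update_mem_tube hh hb'
    have hN1 := summable_norm_famOf_sub hτ0 hτ3 hP hh hh' (m := m)
    have hFh := summable_famOf hτ0 hτ3 (hSm m) hP hh; have hFh' := summable_famOf hτ0 hτ3 (hSm m) hP hh'
    let p₀ : Straddle m := ⟨(m - 1, m), by simp only; omega, le_rfl⟩
    rw [gapStress_eq_tsum, gapStress_eq_tsum, ← hFh.tsum_sub hFh', hN1.of_norm.tsum_eq_add_tsum_ite p₀]
    have hp₀ : famOf a b m h p₀ - famOf a b m (Function.update h m b') p₀ = layerForce a b (-h m) - layerForce a b (-b') := by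
      simp only [famOf, p₀, offsetOf_pred, Function.update_self]
    -- the far remainder
    have hτS : Summable (fun p : Straddle m => τ (p.1.2 - p.1.1).toNat) := summable_of_sum_le (fun p => hτ0 _) (sum_tau_le hτ0 hτ3)
    have hfar : ∑' p : Straddle m, (if p = p₀ then 0 else τ (p.1.2 - p.1.1).toNat) ≤ kap τ 0 - τ 1 := by
      have h1 := hτS.tsum_eq_add_tsum_ite p₀; have h2 := hτS.tsum_le_of_sum_le (sum_tau_le hτ0 hτ3)
      have h3 : τ ((p₀.1.2 - p₀.1.1).toNat) = τ 1 := by simp [p₀]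
      linarith
    have hτS' : Summable (fun p : Straddle m => (if p = p₀ then 0 else τ (p.1.2 - p.1.1).toNat) * ‖h m - b'‖) :=
      (hτS.of_nonneg_of_le (fun p => by split_ifs; exact le_rfl; exact hτ0 _)
        (fun p => by split_ifs; exact hτ0 _; exact le_rfl)).mul_right _
    have hRn : Summable (fun p : Straddle m =>
        ‖if p = p₀ then (0 : E3) else famOf a b m h p - famOf a b m (Function.update h m b') p‖) :=
      hN1.of_nonneg_of_le (fun _ => norm_nonneg _) (fun p => by split_ifs; simp; exact le_rfl)
    have hR : ‖∑' p : Straddle m, (if p = p₀ then (0 : E3) else famOf a b m h p - famOf a b m (Function.update h m b') p)‖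
        ≤ (kap τ 0 - τ 1) * ‖h m - b'‖ := by
      refine (norm_tsum_le_tsum_norm hRn).trans ?_
      refine (Summable.tsum_le_tsum (fun p => ?_) hRn hτS').trans ?_
      · split_ifs with hp
        · simp
        · rw [← offsetOf_sub_offsetOf_update h b' p]
          exact hP _ _ (lt_of_lt_of_le p.2.1 p.2.2) _ _ hh hh'
      · rw [tsum_mul_right]
        exact mul_le_mul_of_nonneg_right hfar (norm_nonneg _)
    have hnear := hmono m (h m) (hh m) b' hb'
    rw [inner_add_left, hp₀]
    have hin := (abs_le.mp (abs_real_inner_le_norm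
      (∑' p : Straddle m, (if p = p₀ then (0 : E3) else famOf a b m h p - famOf a b m (Function.update h m b') p)) (h m - b'))).1
    have hsq : ‖h m - b'‖ ^ 2 = ‖h m - b'‖ * ‖h m - b'‖ := sq _
    nlinarith [hR, norm_nonneg (h m - b'), hnear, hin]
  · -- ℓ¹-Lipschitz
    have hN1 := summable_norm_famOf_sub hτ0 hτ3 hP hh hh' (m := m)
    have hFh := summable_famOf hτ0 hτ3 (hSm m) hP hh; have hFh' := summable_famOf hτ0 hτ3 (hSm m) hP hh'
    rw [gapStress_eq_tsum, gapStress_eq_tsum, ← hFh.tsum_sub hFh']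
    calc ‖∑' p, (famOf a b m h p - famOf a b m h' p)‖ ≤ ∑' p, ‖famOf a b m h p - famOf a b m h' p‖ := norm_tsum_le_tsum_norm hN1
      _ ≤ ∑' i : ℤ, kap τ (i - m) * ‖h i - h' i‖ := hN1.tsum_le_of_sum_le (sum_norm_sub_le hτ0 hτ3 hP hh hh')
      _ = ∑' j : ℤ, kap τ j * ‖h (m + j) - h' (m + j)‖ := by
          rw [← (Equiv.addLeft m).tsum_eq]
          exact tsum_congr fun j => by simp only [Equiv.coe_addLeft, add_sub_cancel_left]

/-- ★ **W ⟸ W_far ∧ W_near** with D1s discharged by the landed `straddleSummable_holds`. -/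
theorem tubeMonotone_of_near_far' {Λ η : ℝ} {K : ℝ → ℝ} (hF : FarPairStiffnessL1 Λ η K) (hN : AdjacentPairDominance Λ η K) :
    TubeMonotone Λ η := tubeMonotone_of_near_far (ChartedPlanarOrderStraddleSummable.straddleSummable_holds Λ) hF hN

/-- ★ **PS_LJ ⟸ W_far ∧ W_near** (E1, D1 ⟸ D1s and D1s are all in the tree: `profileSlavingLJ_of_tubeMonotone`). -/
theorem profileSlavingLJ_of_near_far {Λ η : ℝ} {K : ℝ → ℝ} (hF : FarPairStiffnessL1 Λ η K) (hN : AdjacentPairDominance Λ η K) :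
    ProfileSlavingLJ Λ η := ChartedPlanarOrderStraddleSummable.profileSlavingLJ_of_tubeMonotone (tubeMonotone_of_near_far' hF hN)

end Summit.AtomisticToContinuum.Crystallization.Theorems.ChartedPlanarOrderTubeMonotoneSplit

end
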